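import Literature.MathematicalPhysics.QuantumFieldTheory.ConformalBootstrap3D.MeanFieldFormalExpansion
import Mathlib.Tactic
import HarnessLib

/-!
# Mean-field OPE coefficients in `d = 3` for UNEQUAL external dimensions

Fitzpatrick–Kaplan, JHEP 10 (2012) 032 [arXiv:1112.4845], §2.2 (the last, unnumbered display of the section):
for two generalised free fields `𝒪₁`, `𝒪₂` of dimensions `Δ₁`, `Δ₂` in `d = 2h` dimensions, the double-twist
operators `[𝒪₁𝒪₂]_{n,ℓ}` of dimension `Δ₁ + Δ₂ + 2n + ℓ` and spin `ℓ` appear in `𝒪₁ × 𝒪₂` with squared OPE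
coefficients

  `(c̄^{12}_{n,ℓ})² = 𝒞_{Δ₁}𝒞_{Δ₂} (-1)^ℓ (Δ₁-h+1)_n (Δ₂-h+1)_n (Δ₁)_{ℓ+n} (Δ₂)_{ℓ+n} /
      ( ℓ! n! (ℓ+h)_n (Δ₁+Δ₂+n-2h+1)_n (Δ₁+Δ₂+2n+ℓ-1)_ℓ (Δ₁+Δ₂+n+ℓ-h)_n )`.

This file defines these numbers at `h = 3/2`, `(Δ₁, Δ₂) = (p, q)`, WITHOUT the two-point normalisations
`𝒞_{Δ₁}𝒞_{Δ₂}` and without the sign `(-1)^ℓ` (which in the conventions of the tree's typed blocks is the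
spin-parity sign of sum rule 3 of the `σ–ε` system, carried by the `⟨σεσε⟩` ordering and absent from the
reflection-positive ordering `⟨εσσε⟩`), as the explicit real function `mftCoeffAB p q n ℓ` — the
generalisation of `mftCoeff` (`mftCoeffAB_self : mftCoeffAB p p = mftCoeff p`). Proved: positivity for
`p, q > 1/2` (`mftCoeffAB_pos`), symmetry in `(p, q)` (`mftCoeffAB_comm`), the leading-twist values
(`mftCoeffAB_zero_left`) and the twist recursion with shifted external dimensions

  `P_{n+1,ℓ}(p,q) · (n+1)(2ℓ+2n+3)(n+p+q-1)(2ℓ+2n+2p+2q-1) = p q (2p-1)(2q-1) · P_{n,ℓ}(p+1,q+1)`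

(`mftCoeffAB_succ`) — the algebraic content of the Casimir-pair argument for the mixed mean-field
decompositions (`MeanFieldDecompositionAB`): the left factor is `-ℓ_s(p+q+2n+2+ℓ, ℓ)`, `s = (p+q)/2`, the
diagonal symbol of the closure stencil (`CasimirPairStencil.clDiag`), and `-p q (2p-1)(2q-1) = μ(p,q)` is the
closure constant (`mftMuAB`). The recursion is an exact property of the printed closed form (ours, not a
statement of the source; verified symbolically, pub-ising3d-lit-g10 `code/ab_identities.py`).
No claim about four-point functions is made in this file. [cite: FitzpatrickKaplan2012, §2.2]
-/

namespace Literature.MathematicalPhysics.QuantumFieldTheory.ConformalBootstrap3D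

open Finset

/-! ### The coefficients -/

/-- **The mean-field squared OPE coefficient for unequal dimensions** of the double-twist operator
`[φχ]_{n,ℓ}` (`Δ = p + q + 2n + ℓ`, spin `ℓ`; `Δ_φ = p`, `Δ_χ = q`) in `d = 3` (`h = 3/2`), in the normalisation
`k_{ℓ,0} = 1` of the typed blocks and without sign:
`P_{n,ℓ}(p,q) = (p-1/2)_n (q-1/2)_n (p)_{n+ℓ} (q)_{n+ℓ} / ( ℓ! n! (ℓ+3/2)_n (p+q+n-2)_n (p+q+2n+ℓ-1)_ℓ (p+q+n+ℓ-3/2)_n )`.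
(Fitzpatrick–Kaplan 2012, §2.2, the general-`d` mean-field formula at `(Δ₁,Δ₂) = (p,q)`, `h = 3/2`, without
`𝒞_{Δ₁}𝒞_{Δ₂} (-1)^ℓ`.) [cite: FitzpatrickKaplan2012, §2.2] -/
noncomputable def mftCoeffAB (p q : ℝ) (n ℓ : ℕ) : ℝ :=
  poch (p - 1 / 2) n * poch (q - 1 / 2) n * poch p (n + ℓ) * poch q (n + ℓ) /
    ((ℓ.factorial : ℝ) * (n.factorial : ℝ) * poch ((ℓ : ℝ) + 3 / 2) n * poch (p + q + n - 2) n *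
      poch (p + q + 2 * n + ℓ - 1) ℓ * poch (p + q + n + ℓ - 3 / 2) n)

/-- **Equal dimensions**: `P_{n,ℓ}(p,p) = P_{n,ℓ}(p)` (`mftCoeff`). [cite: FitzpatrickKaplan2012, §2.2] -/
theorem mftCoeffAB_self (p : ℝ) (n ℓ : ℕ) : mftCoeffAB p p n ℓ = mftCoeff p n ℓ := by
  unfold mftCoeffAB mftCoeff
  have e1 : p + p + (n : ℝ) - 2 = 2 * p + n - 2 := by ring
  have e2 : p + p + 2 * (n : ℝ) + ℓ - 1 = 2 * p + 2 * n + ℓ - 1 := by ring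
  have e3 : p + p + (n : ℝ) + ℓ - 3 / 2 = 2 * p + n + ℓ - 3 / 2 := by ring
  rw [e1, e2, e3]
  ring

/-- **Symmetry** in the two external dimensions. [cite: FitzpatrickKaplan2012, §2.2] -/
theorem mftCoeffAB_comm (p q : ℝ) (n ℓ : ℕ) : mftCoeffAB p q n ℓ = mftCoeffAB q p n ℓ := by
  unfold mftCoeffAB
  have e1 : q + p + (n : ℝ) - 2 = p + q + n - 2 := by ring
  have e2 : q + p + 2 * (n : ℝ) + ℓ - 1 = p + q + 2 * n + ℓ - 1 := by ring
  have e3 : q + p + (n : ℝ) + ℓ - 3 / 2 = p + q + n + ℓ - 3 / 2 := by ring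
  rw [e1, e2, e3]
  ring

/-- The denominator of `mftCoeffAB p q n ℓ` is positive for `p, q > 1/2`. [folklore] -/
theorem mftCoeffAB_den_pos {p q : ℝ} (hp : 1 / 2 < p) (hq : 1 / 2 < q) (n ℓ : ℕ) :
    0 < (ℓ.factorial : ℝ) * (n.factorial : ℝ) * poch ((ℓ : ℝ) + 3 / 2) n * poch (p + q + n - 2) n *
      poch (p + q + 2 * n + ℓ - 1) ℓ * poch (p + q + n + ℓ - 3 / 2) n := by
  have h1 : (0 : ℝ) < ℓ.factorial := by positivity
  have h2 : (0 : ℝ) < n.factorial := by positivity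
  have h3 : 0 < poch ((ℓ : ℝ) + 3 / 2) n := poch_pos (by positivity) n
  have hℓ0 : (0 : ℝ) ≤ ℓ := Nat.cast_nonneg ℓ
  have h4 : 0 < poch (p + q + n - 2) n := by
    rcases Nat.eq_zero_or_pos n with h0 | h0
    · subst h0; simp
    · have hn1 : (1 : ℝ) ≤ n := by exact_mod_cast h0
      exact poch_pos (by linarith) n
  have h5 : 0 < poch (p + q + 2 * n + ℓ - 1) ℓ := by
    have hn0 : (0 : ℝ) ≤ n := Nat.cast_nonneg n
    exact poch_pos (by linarith) ℓ
  have h6 : 0 < poch (p + q + n + ℓ - 3 / 2) n := by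
    rcases Nat.eq_zero_or_pos n with h0 | h0
    · subst h0; simp
    · have hn1 : (1 : ℝ) ≤ n := by exact_mod_cast h0
      exact poch_pos (by linarith) n
  positivity

/-- **Positivity**: `P_{n,ℓ}(p,q) > 0` for `p, q > 1/2` (two decoupled generalised free fields strictly above
the scalar unitarity bound form unitary CFT data). [cite: FitzpatrickKaplan2012, §2.2] -/
theorem mftCoeffAB_pos {p q : ℝ} (hp : 1 / 2 < p) (hq : 1 / 2 < q) (n ℓ : ℕ) : 0 < mftCoeffAB p q n ℓ := by
  unfold mftCoeffAB
  have hnum : 0 < poch (p - 1 / 2) n * poch (q - 1 / 2) n * poch p (n + ℓ) * poch q (n + ℓ) := by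
    have h1 : 0 < poch (p - 1 / 2) n := poch_pos (by linarith) n
    have h2 : 0 < poch (q - 1 / 2) n := poch_pos (by linarith) n
    have h3 : 0 < poch p (n + ℓ) := poch_pos (by linarith) _
    have h4 : 0 < poch q (n + ℓ) := poch_pos (by linarith) _
    positivity
  exact div_pos hnum (mftCoeffAB_den_pos hp hq n ℓ)

/-- `P_{n,ℓ}(p,q) ≥ 0` for `p, q > 1/2`. [cite: FitzpatrickKaplan2012, §2.2] -/
theorem mftCoeffAB_nonneg {p q : ℝ} (hp : 1 / 2 < p) (hq : 1 / 2 < q) (n ℓ : ℕ) : 0 ≤ mftCoeffAB p q n ℓ :=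
  (mftCoeffAB_pos hp hq n ℓ).le

/-- **Leading twist**: `P_{0,ℓ}(p,q) = (p)_ℓ (q)_ℓ / (ℓ! (p+q+ℓ-1)_ℓ)`. [cite: FitzpatrickKaplan2012, §2.2] -/
theorem mftCoeffAB_zero_left (p q : ℝ) (ℓ : ℕ) :
    mftCoeffAB p q 0 ℓ = poch p ℓ * poch q ℓ / ((ℓ.factorial : ℝ) * poch (p + q + ℓ - 1) ℓ) := by
  unfold mftCoeffAB
  simp

/-- The closure constant `μ(p,q) = -p q (2p-1)(2q-1)` of the mixed mean-field decompositions (the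
coefficient of `u^{s+1}` in `𝕃 u^s`, `s = (p+q)/2`, for the `⟨σεσε⟩` stencil; `μ(p,p) = mftMu p`). [folklore] -/
noncomputable def mftMuAB (p q : ℝ) : ℝ := -(p * q * (2 * p - 1) * (2 * q - 1))

/-- `μ(p,p) = μ(p)`. [folklore] -/
theorem mftMuAB_self (p : ℝ) : mftMuAB p p = mftMu p := by
  unfold mftMuAB mftMu; ring

/-- `μ(p,q) < 0` for `p, q > 1/2`; in particular `μ ≠ 0`. [folklore] -/
theorem mftMuAB_neg {p q : ℝ} (hp : 1 / 2 < p) (hq : 1 / 2 < q) : mftMuAB p q < 0 := by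
  unfold mftMuAB
  have h1 : 0 < p := by linarith
  have h2 : 0 < q := by linarith
  have h3 : 0 < 2 * p - 1 := by linarith
  have h4 : 0 < 2 * q - 1 := by linarith
  have : 0 < p * q * (2 * p - 1) * (2 * q - 1) := by positivity
  linarith

set_option maxHeartbeats 1600000 in
/-- **The twist recursion with shifted external dimensions** (the algebraic content of the Casimir-pair
argument of `MeanFieldDecompositionAB`): for `p, q > 1/2` and every `n`, `ℓ`,
`P_{n+1,ℓ}(p,q) = p q (2p-1)(2q-1) / ( (n+1)(2ℓ+2n+3)(n+p+q-1)(2ℓ+2n+2p+2q-1) ) · P_{n,ℓ}(p+1,q+1)`. [folklore] -/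
theorem mftCoeffAB_succ {p q : ℝ} (hp : 1 / 2 < p) (hq : 1 / 2 < q) (n ℓ : ℕ) :
    mftCoeffAB p q (n + 1) ℓ =
      p * q * (2 * p - 1) * (2 * q - 1) /
          (((n : ℝ) + 1) * (2 * ℓ + 2 * n + 3) * (n + p + q - 1) * (2 * ℓ + 2 * n + 2 * p + 2 * q - 1)) *
        mftCoeffAB (p + 1) (q + 1) n ℓ := by
  unfold mftCoeffAB
  -- peel the shifted Pochhammer symbols
  have e1 : poch (p - 1 / 2) (n + 1) = (p - 1 / 2) * poch (p + 1 - 1 / 2) n := by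
    rw [poch_succ_left]; ring_nf
  have e1' : poch (q - 1 / 2) (n + 1) = (q - 1 / 2) * poch (q + 1 - 1 / 2) n := by
    rw [poch_succ_left]; ring_nf
  have e2 : poch p (n + 1 + ℓ) = p * poch (p + 1) (n + ℓ) := by
    rw [show n + 1 + ℓ = (n + ℓ) + 1 by ring, poch_succ_left]
  have e2' : poch q (n + 1 + ℓ) = q * poch (q + 1) (n + ℓ) := by
    rw [show n + 1 + ℓ = (n + ℓ) + 1 by ring, poch_succ_left]
  have e3 : ((n + 1).factorial : ℝ) = ((n : ℝ) + 1) * (n.factorial : ℝ) := by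
    rw [Nat.factorial_succ]; push_cast; ring
  have e4 : poch ((ℓ : ℝ) + 3 / 2) (n + 1) = poch ((ℓ : ℝ) + 3 / 2) n * ((ℓ : ℝ) + 3 / 2 + n) :=
    poch_succ _ _
  have e5 : poch (p + q + ↑(n + 1) - 2) (n + 1) = (p + q + n - 1) * poch (p + 1 + (q + 1) + n - 2) n := by
    rw [poch_succ_left]; push_cast; ring_nf
  have e6 : poch (p + q + 2 * ↑(n + 1) + ℓ - 1) ℓ = poch (p + 1 + (q + 1) + 2 * n + ℓ - 1) ℓ := by
    push_cast; ring_nf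
  have e7 : poch (p + q + ↑(n + 1) + ℓ - 3 / 2) (n + 1) =
      (p + q + n + ℓ - 1 / 2) * poch (p + 1 + (q + 1) + n + ℓ - 3 / 2) n := by
    rw [poch_succ_left]; push_cast; ring_nf
  rw [e1, e1', e2, e2', e3, e4, e5, e6, e7]
  have hp1 : 1 / 2 < p + 1 := by linarith
  have hq1 : 1 / 2 < q + 1 := by linarith
  have hden := mftCoeffAB_den_pos hp1 hq1 n ℓ
  have hA : 0 < poch ((ℓ : ℝ) + 3 / 2) n := poch_pos (by positivity) n
  have hn0 : (0 : ℝ) ≤ n := Nat.cast_nonneg n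
  have hℓ0 : (0 : ℝ) ≤ ℓ := Nat.cast_nonneg ℓ
  have hB : 0 < poch (p + 1 + (q + 1) + n - 2) n := poch_pos (by linarith) n
  have hC : 0 < poch (p + 1 + (q + 1) + 2 * n + ℓ - 1) ℓ := poch_pos (by linarith) ℓ
  have hD : 0 < poch (p + 1 + (q + 1) + n + ℓ - 3 / 2) n := poch_pos (by linarith) n
  have hE : (0 : ℝ) < ℓ.factorial := by positivity
  have hF : (0 : ℝ) < n.factorial := by positivity
  have hG : (0 : ℝ) < (n : ℝ) + 1 := by positivity
  have hH : (0 : ℝ) < 2 * ℓ + 2 * n + 3 := by positivity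
  have hI : (0 : ℝ) < n + p + q - 1 := by linarith
  have hJ : (0 : ℝ) < 2 * ℓ + 2 * n + 2 * p + 2 * q - 1 := by linarith
  have hK : (0 : ℝ) < (ℓ : ℝ) + 3 / 2 + n := by positivity
  have hL : (0 : ℝ) < p + q + n + ℓ - 1 / 2 := by linarith
  have hM : (0 : ℝ) < p + q + n - 1 := by linarith
  field_simp
  ring

end Literature.MathematicalPhysics.QuantumFieldTheory.ConformalBootstrap3D
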